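/-
Copyright: lit-balaban Phase-2 proof seat p29 (gen 29).  Statement-level skeleton of a published paper; no proof claims beyond what the
kernel checks below.
-/
import Literature.MathematicalPhysics.QuantumFieldTheory.BalabanImbrieJaffe1984to88.BIJ88Close231RegularTorusCwt
import Literature.MathematicalPhysics.QuantumFieldTheory.BalabanImbrieJaffe1984to88.BIJ88LocDeriv230SmallFieldTorus

/-!
# `BalabanImbrieJaffe1984to88.BIJ88LocHolder230RegularTorus` — T. Bałaban, J. Imbrie, A. Jaffe, *Effective action and cluster properties of
the abelian Higgs model*, Commun. Math. Phys. **114** (1988) 257–315 [BalabanImbrieJaffe1988], Sect. 2 p. 263 [PDF 7], the sentence after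
(2.33): *"Bounds analogous to (2.30), (2.31) hold for covariant derivatives and Hölder derivatives of G_{k,loc}(u) of order less than two"* —
**THE HÖLDER MEMBER OF ORDER `θ ≤ 1` OF (2.30) AT A (2.23)-REGULAR NON-FLAT BACKGROUND `u = e^{ieεA}`, FOR THE PRINTED LOCALIZATION DATA WITH
BIG-BLOCK CUBES** (r18 gen 24's `BIJ88Close231RegularTorusCwt`: the big-block hulls `cubeFamB` of gen 26's torus cubes, the weights `λ_α` of
(2.27), p13's cut-off `ζ″` of (2.29)): the gauge-covariant Hölder quotient `(L^k/|x₁ − x₂|_T)^θ·|u(Γ_{x₁x₂})(G_{k,loc}(u)f)(x₂) − (G_{k,loc}(u)f)(x₁)|`,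
the parallel transport `u(Γ)` taken along a bond chain `Γ` AT THE NON-FLAT FIELD, obeys `(L^kε)²·c₀·m·(1 + L^k((R₀−R₁)⁻¹ + s_g⁻¹))·e^{−δ₀D/L^k}‖f‖_∞`
for every pair of points deep inside the reference box `Ω₀` joined by an admissible contour, every `0 ≤ θ ≤ 1` — the (2.30) companion of
this gen's `BIJ88LocHolder231RegularTorus` ((2.31), same background) and the regular-`u` companion of gen 28's flat `BIJ88LocHolder230FlatTorus`.

statement-level skeleton of published theorems with citation tags; proofs where landed; nothing here is a claim about the Yang–Mills mass gap

PDF held: `paper:balaban1988-cmp114-bij-abelian-higgs-effective-action` (journal page = PDF page + 256); p. 263 [PDF 7] re-read this session on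
the page render `run/shared/lean/pub/lit-balaban/lit-balaban-p31/renders/original-p007-x2.png`; [6] = [Balaban1983RegularityDecay] p. 573
(*"Γ_{x,x′} a shortest contour connecting these points"*, the transport `U(A(Γ_{x,x′}))` of (1.9)) re-read from the text layer of
`paper:balaban1983-cmp89-regularity-decay`.

CITATION HEADER (lean-in-tree rule).  Part of the lit-balaban TYPED SKELETON (HOME `run/shared/lean/pub/lit-balaban/`), PHASE-2 proof seat
p29 gen 29 (unit `lit-balaban-p29-g29`; TAKING line HOME/STATUS.md 2026-08-23T03:4xZ — the row owner r18 gen 24's note of 03:12Z *"importable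
for your θ ≤ 1 Hölder telescoping of (2.30) at regular u too"*; free-target protocol G.5-34(d)).  Rows **C2.Eq2.30** / **C2.Claim@263** (owner
r18; the abstract hence-step is p08's `BIJ88HolderDecay230`, unchanged; the value and covariant-derivative members of (2.30) at the regular
background are r18's `opDecay230_regular_cwt` / `deriv230_regular_cwt` (v1.2 §7), whose inputs are r01's (2.23)-regular providers of [7]
(1.10)).  Kind: theorems only (no definition, no `Prop`-valued fact; r18's / gen 26–29's / T4's declarations used BY NAME).

THE PRINTED TEXT (p. 263, verbatim and IN PRINT ORDER; (2.29) precedes — v1.1 doc-only correction, referee ref-5 D-g65-4 / D-g66-1: the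
earlier header re-ordered the page, inserted the non-printed connective «Hence the following estimates hold» and dropped the leading constant
`c` of (2.30); re-read on the page image `lit-balaban-p31/renders/original-p007-x2.png`; declarations unchanged).  *"The boundary conditions
are always at a distance O(r(e_k)) from x₁, x₂, so a straightforward application of the random walk expansion of [6] shows that
|(G_{k,loc}(u)f)(x)| ≦ ce^{−c dist(suppt f,x)}‖f‖_∞, (2.30) |(G_{k,loc}(u)f − G_k(Ω,u)f)(x)| ≦ e^{−cr(e_k)}e^{−c dist(suppt f,x)}‖f‖_∞, (2.31)
for dist(x, Ω^c) ≧ O(r(e_k)). [Each G_k(□_α,u) is close to G_k(Ω,u) for the relevant x₁, x₂, therefore the convex combination and G_{k,loc}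
are close also.] We assume that u is smooth in the □_α's entering the sum in (2.27); for (2.31) we assume smoothness throughout the subset
Ω ⊂ T_η. This means that in a neighborhood of each □_α there exists an A, λ such that u = exp[ie_kη(A + ∂λ)] with |∂A|, |∂*A| ≦ O(p(e_k)).
(2.32) … Bounds analogous to (2.30), (2.31) hold for covariant derivatives and Hölder derivatives of G_{k,loc}(u) of order less than two."*

THE MECHANISM (ours, declared — gen 29's telescoping with r18's regular-background (2.30) members as the inputs).  NEAR PAIRS
(`|x₁ − x₂|_T ≤ L^k`): along a bond chain `Γ = (x₁ = s_0, …, s_n = x₂)` the transported difference telescopes bond by bond AT THE NON-FLAT `u`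
(gen 29's `BIJ88LocDeriv230SmallFieldTorus.norm_transport_sub_le_sum_covD`: `‖u(Γ)φ(s_n) − φ(s_0)‖ ≤ ε·Σ_m‖(D_uφ)(c_m)‖`, `|u| = 1`), each bond
costing `ε` times r18's covariant-derivative analogue of (2.30) (`deriv230_regular_cwt`) at the support distance `≥ D − |x₁ − x₂|_T ≥ D − L^k`
seen from the contour (`e^{δ₀}` absorbed in `c₀`); the weight `(L^k/T)^θ ≤ L^k/T` (`θ ≤ 1`) against the `≤ (d+1)T` steps leaves `(d+1)·L^kε`.
FAR PAIRS (`|x₁ − x₂|_T > L^k`): weight `≤ 1`, two value members (`opDecay230_regular_cwt`, multiplicity `m` of the labels active at a deep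
point), `|u(Γ)| = 1`.  Both inputs decay at the same explicit rate `δ₀ = 1/(8L^s)`.  ADMISSIBLE CONTOURS (all sites in `Ω₀` at chart depth
`≥ R₀ + R`, within `|x₁ − x₂|_T` of `x₁`, `≤ (d+1)|x₁ − x₂|_T` steps) exist between deep points at torus distance `≤ R₀ + R`: gen 29's chart
staircase `exists_admissible_contour` (§3).

WHAT IS PROVED (theorems only; 0 `sorry`; standard axioms).
* §1 (private) `rpow_le_self_of_one_le`, `exp_near_le`.
* §2 **`holder230_regular_cwt`** — `∃ s₀ ∀ s ≥ s₀ ∃ c₀ e₁ > 0` (from `(d, L, a, e, c, β, s)` only) such that on every torus of the series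
  (`P.d = d+1`, `P.L = L ≥ 2`), at every level `1 ≤ k ≤ K` with `k + s ≤ m + K`, `3L^kL^s ≤ |T^{(0)}|`, for every `A` (2.23)-regular on `T^{(0)}`
  (`0 < e_k ≤ e₁`), `u = e^{ieεA}` (`expGauge P e A`), every reference no-wrap box `Ω₀ = c·L^k + Π_i[0, L^kM₀_i)` shorter than the torus with
  torus gap `≥ R`, grid spacing `s_g ≥ 1`, half-width `W ≥ 2s_g/3 + R₀/2 + R`, radii `R > rowMargin + 1`, `0 ≤ R₁ < R₀`, every `0 ≤ θ ≤ 1`,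
  every admissible bond chain `Γ` from `x₁` to `x₂`, every `f` with `‖f‖_∞ ≤ F` supported at sup-torus distance `≥ D ≥ 0` from both points:
  `(L^k/|x₁ − x₂|_T)^θ·‖u(Γ)(G_{k,loc}(u)f)(x₂) − (G_{k,loc}(u)f)(x₁)‖ ≤ (L^kε)²·c₀·m·(1 + L^k((R₀−R₁)⁻¹ + s_g⁻¹))·e^{−δ₀D/L^k}·F`,
  `δ₀ = 1/(8L^s)`, `m = (⌊(L^k − 1 + R₀)/s_g⌋ + 3)^{d+1}`.
* §3 **`exists_contour_holder230_regular_cwt`** — [6]'s shortest-contour ∃-form: for `x₁, x₂ ∈ Ω₀` at chart depth `≥ R₀ + R` with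
  `|x₁ − x₂|_T ≤ R₀ + R` there is a bond chain of `≤ (d+1)|x₁ − x₂|_T` steps along which §2's bound holds for every `θ`, `f`.
HONEST SCOPE / DIVERGENCE.  (i) `u` is EXACTLY `e^{ieεA}` with `A` (2.23)-regular ON THE WHOLE TORUS (r18's HONEST SCOPE inherited: no change of
gauge — r18's v1.3 `_gaugeOrbit` forms are not restated; bondwise/plaquette-small `u` beyond regular `A` is this gen's
`BIJ88LocDeriv230SmallFieldOpTorus`).  (ii) ORDER `θ ≤ 1` ONLY (quotients of the VALUES of `G_{k,loc}(u)f`); the order `1 + θ` member needs [6]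
(1.9) for the hulls at regular `u` with the transport (r01's `BIJ85NeumannPropagatorRegularHolder`) threaded through p31's `_gen` chain — not
here.  (iii) THE CUBES ARE r18's BIG-BLOCK HULLS `cubeFamB` (r18's divergence (iv)); `G_{k,loc}(u)` is the (2.28) object of THAT family; deep
points only (chart depth `≥ R₀ + R`, `R > rowMargin + 1 = O(L^kL^s)`).  (iv) The transport is T4's ordered holonomy `chainHol` of an arbitrary
admissible chain (print: a shortest contour); far pairs need no admissibility but the statement keeps one shape.  (v) Constants: `s₀, c₀, e₁`
existential (r18's/r01's thresholds; `c₀ = max((d+1)e^{δ₀}c₁, 2c₂)`), `δ₀` explicit; no non-vacuity instance (r18's (v)).  (vi)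
`set_option maxHeartbeats 400000` on §2 (elaboration budget only).  Imports: r18 `BIJ88Close231RegularTorusCwt` (≥ v1.2, → r01
`BIJ85NeumannPropagatorRegularClose`/`…Deriv`, p31, gen 26/27), gen 29 `BIJ88LocDeriv230SmallFieldTorus` (→ T4 `T4TreeGaugeTransform`, p34).
Literature + Mathlib only.  Unit `lit-balaban-p29` (literature-prover-lit-balaban-p29-g29-0), 2026-08-23.  NOT summit progress.
-/

open scoped BigOperators Matrix ComplexConjugate
open Finset Matrix

namespace Literature.MathematicalPhysics.QuantumFieldTheory.BalabanImbrieJaffe1984to88.BIJ88LocHolder230RegularTorus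

open Literature.MathematicalPhysics.QuantumFieldTheory.Balaban1983to89
open BIJ88Sect3Statements (U1 toC cfg covD norm_toC)
open BIJ85BlockAveragesTorus BIJ85BlockAveragesTorusK
open BIJ88NeumannPropagator227Torus (gBox)
open BIJ88DeltaLoc234Torus (gLocT)
open BIJ88NeumannPropagatorFlatDecayCube
open BIJ88Cutoffs21 (cutoff)
open BIJ88LocWeights227Torus
open BIJ85CovariantHiggsDictionary (expGauge)
open BIJ88Close231RegularTorusCwt (cubeFamB rowMargin deriv230_regular_cwt opDecay230_regular_cwt)
open BIJ88LocDeriv230SmallFieldTorus (norm_transport_sub_le_sum_covD exists_admissible_contour)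
open T4TreeGaugeFixing (Joins)
open T4TreeGaugeTransform (chainHol)

noncomputable section

variable {d : ℕ} {P : Params}

/-! ## §1 Kernel lemmas -/

/-- kernel: for `1 ≤ t` and `θ ≤ 1`, `t^θ ≤ t`. [folklore] -/
private theorem rpow_le_self_of_one_le {t θ : ℝ} (ht : 1 ≤ t) (hθ : θ ≤ 1) : t ^ θ ≤ t := by
  have h := Real.rpow_le_rpow_of_exponent_le ht hθ
  rwa [Real.rpow_one] at h

/-- kernel: `exp (-(t * (n⁻¹ * T))) ≤ exp t * exp (-(t * (n⁻¹ * D)))` when `0 < t`, `0 < n`, `0 ≤ D`, `D - n ≤ T`. [folklore] -/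
private theorem exp_near_le {t n D T : ℝ} (ht : 0 < t) (hn : 0 < n) (hT : D - n ≤ T) :
    Real.exp (-(t * (n⁻¹ * T))) ≤ Real.exp t * Real.exp (-(t * (n⁻¹ * D))) := by
  rw [← Real.exp_add]
  refine Real.exp_le_exp.2 ?_
  have h1 : n⁻¹ * (D - n) ≤ n⁻¹ * T := mul_le_mul_of_nonneg_left hT (inv_pos.2 hn).le
  have h2 : n⁻¹ * (D - n) = n⁻¹ * D - 1 := by field_simp
  have h4 : t * (n⁻¹ * D - 1) ≤ t * (n⁻¹ * T) := mul_le_mul_of_nonneg_left (h2 ▸ h1) ht.le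
  nlinarith

/-! ## §2 The Hölder member of order `θ ≤ 1` of (2.30) at a (2.23)-regular background, along admissible contours -/

section Holder

set_option maxHeartbeats 400000 in
/-- **THE HÖLDER MEMBER OF ORDER `θ ≤ 1` OF (2.30) AT A (2.23)-REGULAR NON-FLAT BACKGROUND `u = e^{ieεA}`, FOR THE PRINTED LOCALIZATION DATA
WITH BIG-BLOCK CUBES, ALONG EVERY ADMISSIBLE CONTOUR** (p. 263: *"|(G_{k,loc}(u)f)(x)| ≦ ce^{−c dist(suppt f,x)}‖f‖_∞ (2.30) … Bounds
analogous to (2.30), (2.31) hold for covariant derivatives and Hölder derivatives of G_{k,loc}(u) of order less than two"*; [6] p. 573 (1.9): the transport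
`U(A(Γ_{x,x′}))` along *"a shortest contour connecting these points"*).  `∃ s₀ ∀ s ≥ s₀ ∃ c₀ e₁ > 0` (from `(d, L, a, e, c, β, s)` only) such
that on every torus of the series (`P.d = d+1`, `P.L = L ≥ 2`), at every level `1 ≤ k ≤ K` with `k + s ≤ m + K`, `3L^kL^s ≤ |T^{(0)}|`, for every
`A` (2.23)-regular on `T^{(0)}` (`0 < e_k ≤ e₁`), every reference no-wrap box `Ω₀ = c·L^k + Π_i[0, L^kM₀_i)` shorter than the torus with torus
gap `≥ R`, grid spacing `s_g ≥ 1`, half-width `W ≥ 2s_g/3 + R₀/2 + R`, radii `R > rowMargin + 1`, `0 ≤ R₁ < R₀`, EVERY exponent `0 ≤ θ ≤ 1`,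
every pair `x₁, x₂` joined by a bond chain `Γ = (x₁ = s_0, …, s_n = x₂)` of `n ≤ (d+1)|x₁ − x₂|_T` steps all of whose sites lie in `Ω₀` at chart
depth `≥ R₀ + R` and within sup-torus distance `|x₁ − x₂|_T` of `x₁` (§3: the chart staircase), and every `f` with `‖f‖_∞ ≤ F` supported at
sup-torus distance `≥ D ≥ 0` from `x₁` and from `x₂`:
`(L^k/|x₁ − x₂|_T)^θ·‖u(Γ)(G_{k,loc}(u)f)(x₂) − (G_{k,loc}(u)f)(x₁)‖ ≤ (L^kε)²·c₀·m·(1 + L^k((R₀−R₁)⁻¹ + s_g⁻¹))·e^{−δ₀D/L^k}·F`, `δ₀ = 1/(8L^s)`,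
`m = (⌊(L^k−1+R₀)/s_g⌋+3)^{d+1}`, `u(Γ) = Π_m u(c_m)^{±1}` (T4's `chainHol`) — NEAR PAIRS (`|x₁ − x₂|_T ≤ L^k`): r18's covariant-derivative
analogue of (2.30) (`deriv230_regular_cwt`) telescoped bond by bond along `Γ` at the non-flat `u` (p29's `norm_transport_sub_le_sum_covD`),
`(L^k/T)^θ·(d+1)T·ε ≤ (d+1)L^kε`, support distance `≥ D − L^k` from the contour (`e^{δ₀}` absorbed in `c₀`); FAR PAIRS: two value members
(`opDecay230_regular_cwt`), `|u(Γ)| = 1`. [cite: BalabanImbrieJaffe1988, (2.30) p.263] -/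
theorem holder230_regular_cwt (d L : ℕ) (hL : 2 ≤ L) {a : ℝ} (ha : 0 < a) (e creg β : ℝ) (hcreg : 0 ≤ creg) (hβ : 0 < β) :
    ∃ s₀ : ℕ, ∀ s : ℕ, s₀ ≤ s → ∃ c₀ e₁ : ℝ, 0 < c₀ ∧ 0 < e₁ ∧
      ∀ (P : Params) (hPd : P.d = d + 1), P.L = L → ∀ (k : ℕ), 1 ≤ k → k ≤ P.K → k + s ≤ P.m + P.K →
      3 * (L ^ k * L ^ s) ≤ P.sitesPerDir 0 →
      ∀ (A : PBond P 0 → ℝ) (ec : ℝ), 0 < ec → ec ≤ e₁ →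
      (∀ (z : Balaban1983to89.Site P 0) (μ ν : Fin P.d),
          P.spacing k * |e| / ec * |A ⟨z.shift μ, ν⟩ - A ⟨z, ν⟩| ≤ creg * ec ^ (β - 1) / (L : ℝ) ^ k) →
      ∀ (c M0 : Fin (d + 1) → ℕ), (∀ i, c i * P.L ^ k + P.L ^ k * M0 i ≤ P.sitesPerDir 0) → (∀ i, P.L ^ k * M0 i < P.sitesPerDir 0) →
      ∀ (sg W : ℕ), 1 ≤ sg → ∀ (R R₀ R₁ : ℝ), ((rowMargin L (d + 1) k s : ℕ) : ℝ) + 1 < R → 0 ≤ R₁ → R₁ < R₀ →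
        2 * (sg : ℝ) / 3 + R₀ / 2 + R ≤ W → (∀ i, ((P.L ^ k * M0 i : ℕ) : ℝ) + R ≤ P.sitesPerDir 0) →
      ∀ (θ : ℝ), 0 ≤ θ → θ ≤ 1 →
      ∀ (x₁ x₂ : Balaban1983to89.Site P 0) (n : ℕ) (sq : ℕ → Balaban1983to89.Site P 0) (cb : ℕ → PBond P 0),
        sq 0 = x₁ → sq n = x₂ → (∀ m < n, Joins (cb m) (sq m) (sq (m + 1))) →
        (n : ℝ) ≤ ((d : ℝ) + 1) * B5Ineq137Torus.T P 0 x₁ x₂ →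
        (∀ m ≤ n, sq m ∈ (cubeT hPd (P.L ^ k) c fun i => P.L ^ k * M0 i) ∧
          (∀ i, R₀ + R ≤ (boxCoord hPd (P.L ^ k) c (sq m) i : ℝ) ∧
            (boxCoord hPd (P.L ^ k) c (sq m) i : ℝ) + (R₀ + R) ≤ (P.L ^ k * M0 i : ℕ) - 1) ∧
          B5Ineq137Torus.T P 0 x₁ (sq m) ≤ B5Ineq137Torus.T P 0 x₁ x₂) →
      ∀ (f : Balaban1983to89.Site P 0 → ℂ) (F D : ℝ), (∀ y, ‖f y‖ ≤ F) → 0 ≤ D →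
        (∀ y, f y ≠ 0 → D ≤ B5Ineq137Torus.T P 0 x₁ y) → (∀ y, f y ≠ 0 → D ≤ B5Ineq137Torus.T P 0 x₂ y) →
        ((P.L : ℝ) ^ k / B5Ineq137Torus.T P 0 x₁ x₂) ^ θ *
          ‖toC (chainHol sq cb (expGauge P e A) n) *
              (gLocT (B1RG242Torus.α P a k * (P.L : ℝ) ^ (k * P.d)) P.eps⁻¹ (expGauge P e A) k
                (cubeFamB hPd (P.L ^ k) c M0 sg W (L ^ k * L ^ s)) (lamFam hPd (P.L ^ k) c M0 sg)
                (cutoff R₁ R₀ (B5Ineq137Torus.T P 0)) *ᵥ f) x₂ -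
            (gLocT (B1RG242Torus.α P a k * (P.L : ℝ) ^ (k * P.d)) P.eps⁻¹ (expGauge P e A) k
                (cubeFamB hPd (P.L ^ k) c M0 sg W (L ^ k * L ^ s)) (lamFam hPd (P.L ^ k) c M0 sg)
                (cutoff R₁ R₀ (B5Ineq137Torus.T P 0)) *ᵥ f) x₁‖ ≤
          P.spacing k ^ 2 * (c₀ * (⌊(((P.L : ℝ) ^ k) - 1 + R₀) / sg⌋₊ + 3) ^ (d + 1) * (1 + (P.L : ℝ) ^ k * ((R₀ - R₁)⁻¹ + (sg : ℝ)⁻¹)) *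
            Real.exp (-(1 / (8 * (L : ℝ) ^ s) * (((P.L : ℝ) ^ k)⁻¹ * D))) * F) := by
  obtain ⟨s₁, H1⟩ := deriv230_regular_cwt d L hL ha e creg β hcreg hβ
  obtain ⟨s₂, H2⟩ := opDecay230_regular_cwt d L hL ha e creg β hcreg hβ
  refine ⟨max s₁ s₂, fun s hs => ?_⟩
  obtain ⟨c₁, e₁, hc₁, he₁, G1⟩ := H1 s ((le_max_left _ _).trans hs)
  obtain ⟨c₂, e₂, hc₂, he₂, G2⟩ := H2 s ((le_max_right _ _).trans hs)
  set δ₀ : ℝ := 1 / (8 * (L : ℝ) ^ s) with hδ₀def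
  refine ⟨max (((d : ℝ) + 1) * Real.exp δ₀ * c₁) (2 * c₂), min e₁ e₂, lt_max_of_lt_right (by positivity), lt_min he₁ he₂, ?_⟩
  intro P hPd hPL k hk1 hkK hks hsize A ec hec hece hreg c M0 hfit0 hN0 sg W hsg R R₀ R₁ hRm hR₁ hR10 hW hgap θ hθ0 hθ1
    x₁ x₂ n sq cb hsq0 hsqn hJ hnle hchain f F D hF hD hsupp₁ hsupp₂
  have hece₁ : ec ≤ e₁ := hece.trans (min_le_left _ _)
  have hece₂ : ec ≤ e₂ := hece.trans (min_le_right _ _)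
  have hRm' : ((rowMargin L (d + 1) k s : ℕ) : ℝ) < R := by linarith
  set C := max (((d : ℝ) + 1) * Real.exp δ₀ * c₁) (2 * c₂) with hCdef
  have hC1 : ((d : ℝ) + 1) * Real.exp δ₀ * c₁ ≤ C := le_max_left _ _
  have hC2 : 2 * c₂ ≤ C := le_max_right _ _
  have hC0 : 0 ≤ C := le_trans (by positivity) hC2
  have hLr : (0 : ℝ) < L := by exact_mod_cast (show 0 < L by omega)
  have hδ₀0 : 0 < δ₀ := by rw [hδ₀def]; positivity
  have hLpos : (0 : ℝ) < P.L := P.cast_L_pos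
  have hLk : (0 : ℝ) < (P.L : ℝ) ^ k := pow_pos hLpos _
  have hLkinv : 0 < ((P.L : ℝ) ^ k)⁻¹ := inv_pos.mpr hLk
  have hF0 : 0 ≤ F := (norm_nonneg _).trans (hF x₁)
  have hsp0 : 0 < P.spacing k := P.spacing_pos k
  have heps : 0 < P.eps := P.eps_pos
  have hsr : (0 : ℝ) < sg := by exact_mod_cast hsg
  have hgap' : 0 < R₀ - R₁ := sub_pos.2 hR10
  have hT0 : 0 ≤ B5Ineq137Torus.T P 0 x₁ x₂ := B5Ineq137Torus.T_nonneg P 0 x₁ x₂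
  -- the end points are chain sites
  obtain ⟨hx₁, hdeep₁, -⟩ := hsq0 ▸ hchain 0 (Nat.zero_le n)
  obtain ⟨hx₂, hdeep₂, -⟩ := hsqn ▸ hchain n le_rfl
  -- abbreviations
  set Aop : ℝ := B1RG242Torus.α P a k * (P.L : ℝ) ^ (k * P.d) with hAdef
  set U : GaugeField P 0 U1 := expGauge P e A with hUdef
  set ψ : Balaban1983to89.Site P 0 → ℂ :=
    gLocT Aop P.eps⁻¹ U k (cubeFamB hPd (P.L ^ k) c M0 sg W (L ^ k * L ^ s)) (lamFam hPd (P.L ^ k) c M0 sg)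
      (cutoff R₁ R₀ (B5Ineq137Torus.T P 0)) *ᵥ f with hψdef
  set T12 : ℝ := B5Ineq137Torus.T P 0 x₁ x₂ with hT12def
  set m : ℝ := ((⌊(((P.L : ℝ) ^ k) - 1 + R₀) / sg⌋₊ : ℝ) + 3) ^ (d + 1) with hmdef
  have hm0 : 0 ≤ m := by rw [hmdef]; positivity
  set br : ℝ := 1 + (P.L : ℝ) ^ k * ((R₀ - R₁)⁻¹ + (sg : ℝ)⁻¹) with hbrdef
  have hbr1 : 1 ≤ br := by rw [hbrdef]; exact le_add_of_nonneg_right (by positivity)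
  have hbr0 : 0 ≤ br := zero_le_one.trans hbr1
  set Ex : ℝ := Real.exp (-(δ₀ * (((P.L : ℝ) ^ k)⁻¹ * D))) with hEdef
  have hE0 : 0 < Ex := Real.exp_pos _
  have hεD : 0 ≤ ((P.L : ℝ) ^ k)⁻¹ * D := mul_nonneg hLkinv.le hD
  -- the weight
  set w : ℝ := ((P.L : ℝ) ^ k / T12) ^ θ with hwdef
  have hw0 : 0 ≤ w := Real.rpow_nonneg (div_nonneg hLk.le hT0) θ
  show w * ‖toC (chainHol sq cb U n) * ψ x₂ - ψ x₁‖ ≤ _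
  -- the target, factorised
  have hRHS : P.spacing k ^ 2 * (C * m * br * Ex * F) =
      P.spacing k ^ 2 * (C * (⌊(((P.L : ℝ) ^ k) - 1 + R₀) / sg⌋₊ + 3) ^ (d + 1) * (1 + (P.L : ℝ) ^ k * ((R₀ - R₁)⁻¹ + (sg : ℝ)⁻¹)) *
        Real.exp (-(δ₀ * (((P.L : ℝ) ^ k)⁻¹ * D))) * F) := by
    rw [hmdef, hbrdef, hEdef]
  rw [← hRHS]
  by_cases hnear : T12 ≤ (P.L : ℝ) ^ k
  · /- NEAR PAIRS: r18's derivative member telescoped along the contour at the non-flat `u` -/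
    set D' : ℝ := max (D - T12) 0 with hD'def
    have hD'0 : 0 ≤ D' := le_max_right _ _
    set B₁ : ℝ := P.spacing k * (c₁ * (((⌊(((P.L : ℝ) ^ k) - 1 + R₀) / sg⌋₊ : ℝ) + 3) ^ (d + 1)) *
      (1 + (P.L : ℝ) ^ k * ((R₀ - R₁)⁻¹ + (sg : ℝ)⁻¹)) * Real.exp (-(1 / (8 * (L : ℝ) ^ s) * (((P.L : ℝ) ^ k)⁻¹ * D'))) * F)
      with hB₁def
    have hB₁0 : 0 ≤ B₁ := by rw [hB₁def]; positivity
    have hbond : ∀ m' < n, ‖covD P.eps⁻¹ (cfg U) ψ (cb m')‖ ≤ B₁ := by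
      intro m' hm'
      obtain ⟨hmem0, hdeep0, hclose0⟩ := hchain m' hm'.le
      obtain ⟨hmem1, hdeep1, hclose1⟩ := hchain (m' + 1) (Nat.succ_le_of_lt hm')
      have hb : cb m' = ⟨(cb m').src, (cb m').dir⟩ := rfl
      have htgt : (cb m').tgt = (cb m').src.shift (cb m').dir := rfl
      have hends : ((cb m').src ∈ (cubeT hPd (P.L ^ k) c fun i => P.L ^ k * M0 i) ∧
          (∀ i, R₀ + R ≤ (boxCoord hPd (P.L ^ k) c (cb m').src i : ℝ) ∧
            (boxCoord hPd (P.L ^ k) c (cb m').src i : ℝ) + (R₀ + R) ≤ (P.L ^ k * M0 i : ℕ) - 1) ∧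
          B5Ineq137Torus.T P 0 x₁ (cb m').src ≤ T12) ∧
          ((cb m').src.shift (cb m').dir ∈ (cubeT hPd (P.L ^ k) c fun i => P.L ^ k * M0 i) ∧
          (∀ i, R₀ + R ≤ (boxCoord hPd (P.L ^ k) c ((cb m').src.shift (cb m').dir) i : ℝ) ∧
            (boxCoord hPd (P.L ^ k) c ((cb m').src.shift (cb m').dir) i : ℝ) + (R₀ + R) ≤ (P.L ^ k * M0 i : ℕ) - 1)) := by
        rw [← htgt]
        rcases hJ m' hm' with ⟨h1, h2⟩ | ⟨h1, h2⟩
        · rw [h1, h2]; exact ⟨⟨hmem0, hdeep0, hclose0⟩, hmem1, hdeep1⟩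
        · rw [h1, h2]; exact ⟨⟨hmem1, hdeep1, hclose1⟩, hmem0, hdeep0⟩
      obtain ⟨⟨hzmem, hzdeep, hzclose⟩, hzemem, hzedeep⟩ := hends
      have hD'supp : ∀ y, f y ≠ 0 → D' ≤ B5Ineq137Torus.T P 0 (cb m').src y := by
        intro y hy
        refine max_le ?_ (B5Ineq137Torus.T_nonneg P 0 _ y)
        have h1 := hsupp₁ y hy
        have h2 := B5Ineq137Torus.T_triangle P 0 x₁ (cb m').src y
        linarith
      have hder := G1 P hPd hPL k hk1 hkK hks hsize A ec hec hece₁ hreg c M0 hfit0 hN0 sg W hsg R R₀ R₁ hRm hR₁ hR10 hW hgap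
        (cb m').src (cb m').dir hzmem hzdeep hzemem hzedeep f F D' hF hD'0 hD'supp
      rw [← hb] at hder
      exact hder
    -- telescoping along the contour
    have htel := norm_transport_sub_le_sum_covD U (inv_ne_zero heps.ne') ψ sq cb n hJ
    rw [hsq0, hsqn, abs_inv, abs_of_pos heps, inv_inv] at htel
    have hsum : ∑ m' ∈ Finset.range n, ‖covD P.eps⁻¹ (cfg U) ψ (cb m')‖ ≤ n * B₁ := by
      calc ∑ m' ∈ Finset.range n, ‖covD P.eps⁻¹ (cfg U) ψ (cb m')‖ ≤ ∑ _m' ∈ Finset.range n, B₁ :=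
            Finset.sum_le_sum fun m' hm' => hbond m' (Finset.mem_range.1 hm')
        _ = n * B₁ := by rw [Finset.sum_const, Finset.card_range, nsmul_eq_mul]
    have hdiff : ‖toC (chainHol sq cb U n) * ψ x₂ - ψ x₁‖ ≤ P.eps * (n * B₁) :=
      htel.trans (mul_le_mul_of_nonneg_left hsum heps.le)
    -- the exponent: `D' ≥ D − T12 ≥ D − L^k`
    have hTz : D - (P.L : ℝ) ^ k ≤ D' := le_trans (by linarith) (le_max_left _ _)
    have hexpD' : Real.exp (-(δ₀ * (((P.L : ℝ) ^ k)⁻¹ * D'))) ≤ Real.exp δ₀ * Ex := exp_near_le hδ₀0 hLk hTz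
    have hB₁le : B₁ ≤ P.spacing k * (Real.exp δ₀ * c₁ * m * br * Ex * F) := by
      rw [hB₁def, ← hmdef, ← hbrdef, ← hδ₀def]
      refine mul_le_mul_of_nonneg_left ?_ hsp0.le
      calc c₁ * m * br * Real.exp (-(δ₀ * (((P.L : ℝ) ^ k)⁻¹ * D'))) * F ≤ c₁ * m * br * (Real.exp δ₀ * Ex) * F :=
            mul_le_mul_of_nonneg_right (mul_le_mul_of_nonneg_left hexpD' (by positivity)) hF0
        _ = Real.exp δ₀ * c₁ * m * br * Ex * F := by ring
    -- the weight against the number of steps: `w·ε·n ≤ (d+1)·L^k·ε`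
    have hwT : w * (P.eps * (n * B₁)) ≤ ((d : ℝ) + 1) * (P.eps * (P.L : ℝ) ^ k) * B₁ := by
      rcases hT0.eq_or_lt with hT00 | hTpos
      · have hn0 : (n : ℝ) = 0 := le_antisymm (by rw [← hT00, mul_zero] at hnle; exact hnle) (Nat.cast_nonneg n)
        rw [hn0, zero_mul, mul_zero, mul_zero]
        positivity
      · have hq : 1 ≤ (P.L : ℝ) ^ k / T12 := by rw [le_div_iff₀ hTpos, one_mul]; exact hnear
        have hw1 : w ≤ (P.L : ℝ) ^ k / T12 := rpow_le_self_of_one_le hq hθ1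
        calc w * (P.eps * (n * B₁)) ≤ (P.L : ℝ) ^ k / T12 * (P.eps * ((((d : ℝ) + 1) * T12) * B₁)) :=
              mul_le_mul hw1 (mul_le_mul_of_nonneg_left (mul_le_mul_of_nonneg_right hnle hB₁0) heps.le) (by positivity)
                (div_nonneg hLk.le hT0)
          _ = ((d : ℝ) + 1) * (P.eps * (P.L : ℝ) ^ k) * B₁ := by
              rw [div_mul_eq_mul_div, div_eq_iff hTpos.ne']
              ring
    have hspacing : P.eps * (P.L : ℝ) ^ k = P.spacing k := by rw [Params.spacing]; ring
    calc w * ‖toC (chainHol sq cb U n) * ψ x₂ - ψ x₁‖ ≤ w * (P.eps * (n * B₁)) := mul_le_mul_of_nonneg_left hdiff hw0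
      _ ≤ ((d : ℝ) + 1) * (P.eps * (P.L : ℝ) ^ k) * B₁ := hwT
      _ ≤ ((d : ℝ) + 1) * P.spacing k * (P.spacing k * (Real.exp δ₀ * c₁ * m * br * Ex * F)) := by
          rw [hspacing]; exact mul_le_mul_of_nonneg_left hB₁le (by positivity)
      _ = P.spacing k ^ 2 * ((((d : ℝ) + 1) * Real.exp δ₀ * c₁) * m * br * Ex * F) := by ring
      _ ≤ P.spacing k ^ 2 * (C * m * br * Ex * F) := by
          refine mul_le_mul_of_nonneg_left ?_ (sq_nonneg _)
          exact mul_le_mul_of_nonneg_right (mul_le_mul_of_nonneg_right (mul_le_mul_of_nonneg_right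
            (mul_le_mul_of_nonneg_right hC1 hm0) hbr0) hE0.le) hF0
  · /- FAR PAIRS: two (2.30) value members, `|u(Γ)| = 1` -/
    push Not at hnear
    have hTpos : 0 < T12 := hLk.trans hnear
    have hw1 : w ≤ 1 := by
      refine Real.rpow_le_one (div_nonneg hLk.le hT0) ?_ hθ0
      rw [div_le_one hTpos]; exact hnear.le
    have hv₁ := G2 P hPd hPL k hk1 hkK hks hsize A ec hec hece₂ hreg c M0 hfit0 sg W hsg R R₀ R₁ hRm' hR₁ hR10 hW hgap x₁ hx₁ hdeep₁
      f F D hF hD hsupp₁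
    have hv₂ := G2 P hPd hPL k hk1 hkK hks hsize A ec hec hece₂ hreg c M0 hfit0 sg W hsg R R₀ R₁ hRm' hR₁ hR10 hW hgap x₂ hx₂ hdeep₂
      f F D hF hD hsupp₂
    have hval : ∀ x : Balaban1983to89.Site P 0,
        ‖ψ x‖ ≤ P.spacing k ^ 2 * ((((⌊(((P.L : ℝ) ^ k) - 1 + R₀) / sg⌋₊ : ℝ) + 3) ^ (d + 1)) *
          (c₂ * Real.exp (-(1 / (8 * (L : ℝ) ^ s) * (((P.L : ℝ) ^ k)⁻¹ * D))) * F)) → ‖ψ x‖ ≤ P.spacing k ^ 2 * (m * (c₂ * Ex * F)) := by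
      intro x hx
      rw [← hmdef, ← hδ₀def, ← hEdef] at hx
      exact hx
    have h1 := hval x₁ hv₁
    have h2 := hval x₂ hv₂
    have hsub : ‖toC (chainHol sq cb U n) * ψ x₂ - ψ x₁‖ ≤ P.spacing k ^ 2 * (m * (c₂ * Ex * F)) + P.spacing k ^ 2 * (m * (c₂ * Ex * F)) := by
      refine (norm_sub_le _ _).trans (add_le_add ?_ h1)
      rw [norm_mul, norm_toC, one_mul]; exact h2
    calc w * ‖toC (chainHol sq cb U n) * ψ x₂ - ψ x₁‖ ≤ ‖toC (chainHol sq cb U n) * ψ x₂ - ψ x₁‖ :=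
          mul_le_of_le_one_left (norm_nonneg _) hw1
      _ ≤ P.spacing k ^ 2 * (m * (c₂ * Ex * F)) + P.spacing k ^ 2 * (m * (c₂ * Ex * F)) := hsub
      _ = P.spacing k ^ 2 * ((2 * c₂) * m * 1 * Ex * F) := by ring
      _ ≤ P.spacing k ^ 2 * (C * m * br * Ex * F) := by
          refine mul_le_mul_of_nonneg_left ?_ (sq_nonneg _)
          exact mul_le_mul_of_nonneg_right (mul_le_mul_of_nonneg_right
            (mul_le_mul (mul_le_mul_of_nonneg_right hC2 hm0) hbr1 zero_le_one (by positivity)) hE0.le) hF0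

end Holder

/-! ## §3 The member along the chart staircase: [6]'s *"shortest contour Γ_{x,x′}"* form for near deep pairs -/

section ShortestContour

/-- **THE HÖLDER MEMBER OF ORDER `θ ≤ 1` OF (2.30) AT A (2.23)-REGULAR BACKGROUND, ALONG A SHORTEST CONTOUR** ([6] (1.9)'s form: *"Here
Γ_{x,x′} denotes a shortest contour connecting the points x, x′"*): with the thresholds and constants of `holder230_regular_cwt`, for every pair
`x₁, x₂ ∈ Ω₀` at chart depth `≥ R₀ + R` with `|x₁ − x₂|_T ≤ R₀ + R` THERE IS a bond chain `Γ` from `x₁` to `x₂` of `≤ (d+1)|x₁ − x₂|_T` steps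
(p29's chart staircase `exists_admissible_contour`) along which, for every `0 ≤ θ ≤ 1` and every `f` with `‖f‖_∞ ≤ F` supported at sup-torus
distance `≥ D ≥ 0` from both points, the bound of `holder230_regular_cwt` holds. [cite: BalabanImbrieJaffe1988, (2.30) p.263] -/
theorem exists_contour_holder230_regular_cwt (d L : ℕ) (hL : 2 ≤ L) {a : ℝ} (ha : 0 < a) (e creg β : ℝ) (hcreg : 0 ≤ creg)
    (hβ : 0 < β) :
    ∃ s₀ : ℕ, ∀ s : ℕ, s₀ ≤ s → ∃ c₀ e₁ : ℝ, 0 < c₀ ∧ 0 < e₁ ∧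
      ∀ (P : Params) (hPd : P.d = d + 1), P.L = L → ∀ (k : ℕ), 1 ≤ k → k ≤ P.K → k + s ≤ P.m + P.K →
      3 * (L ^ k * L ^ s) ≤ P.sitesPerDir 0 →
      ∀ (A : PBond P 0 → ℝ) (ec : ℝ), 0 < ec → ec ≤ e₁ →
      (∀ (z : Balaban1983to89.Site P 0) (μ ν : Fin P.d),
          P.spacing k * |e| / ec * |A ⟨z.shift μ, ν⟩ - A ⟨z, ν⟩| ≤ creg * ec ^ (β - 1) / (L : ℝ) ^ k) →
      ∀ (c M0 : Fin (d + 1) → ℕ), (∀ i, c i * P.L ^ k + P.L ^ k * M0 i ≤ P.sitesPerDir 0) → (∀ i, P.L ^ k * M0 i < P.sitesPerDir 0) →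
      ∀ (sg W : ℕ), 1 ≤ sg → ∀ (R R₀ R₁ : ℝ), ((rowMargin L (d + 1) k s : ℕ) : ℝ) + 1 < R → 0 ≤ R₁ → R₁ < R₀ →
        2 * (sg : ℝ) / 3 + R₀ / 2 + R ≤ W → (∀ i, ((P.L ^ k * M0 i : ℕ) : ℝ) + R ≤ P.sitesPerDir 0) →
      ∀ (x₁ x₂ : Balaban1983to89.Site P 0),
        x₁ ∈ (cubeT hPd (P.L ^ k) c fun i => P.L ^ k * M0 i) →
        (∀ i, R₀ + R ≤ (boxCoord hPd (P.L ^ k) c x₁ i : ℝ) ∧ (boxCoord hPd (P.L ^ k) c x₁ i : ℝ) + (R₀ + R) ≤ (P.L ^ k * M0 i : ℕ) - 1) →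
        x₂ ∈ (cubeT hPd (P.L ^ k) c fun i => P.L ^ k * M0 i) →
        (∀ i, R₀ + R ≤ (boxCoord hPd (P.L ^ k) c x₂ i : ℝ) ∧ (boxCoord hPd (P.L ^ k) c x₂ i : ℝ) + (R₀ + R) ≤ (P.L ^ k * M0 i : ℕ) - 1) →
        B5Ineq137Torus.T P 0 x₁ x₂ ≤ R₀ + R →
      ∃ (N : ℕ) (sq : ℕ → Balaban1983to89.Site P 0) (cb : ℕ → PBond P 0), sq 0 = x₁ ∧ sq N = x₂ ∧
        (∀ m < N, Joins (cb m) (sq m) (sq (m + 1))) ∧ (N : ℝ) ≤ ((d : ℝ) + 1) * B5Ineq137Torus.T P 0 x₁ x₂ ∧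
      ∀ (θ : ℝ), 0 ≤ θ → θ ≤ 1 →
      ∀ (f : Balaban1983to89.Site P 0 → ℂ) (F D : ℝ), (∀ y, ‖f y‖ ≤ F) → 0 ≤ D →
        (∀ y, f y ≠ 0 → D ≤ B5Ineq137Torus.T P 0 x₁ y) → (∀ y, f y ≠ 0 → D ≤ B5Ineq137Torus.T P 0 x₂ y) →
        ((P.L : ℝ) ^ k / B5Ineq137Torus.T P 0 x₁ x₂) ^ θ *
          ‖toC (chainHol sq cb (expGauge P e A) N) *
              (gLocT (B1RG242Torus.α P a k * (P.L : ℝ) ^ (k * P.d)) P.eps⁻¹ (expGauge P e A) k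
                (cubeFamB hPd (P.L ^ k) c M0 sg W (L ^ k * L ^ s)) (lamFam hPd (P.L ^ k) c M0 sg)
                (cutoff R₁ R₀ (B5Ineq137Torus.T P 0)) *ᵥ f) x₂ -
            (gLocT (B1RG242Torus.α P a k * (P.L : ℝ) ^ (k * P.d)) P.eps⁻¹ (expGauge P e A) k
                (cubeFamB hPd (P.L ^ k) c M0 sg W (L ^ k * L ^ s)) (lamFam hPd (P.L ^ k) c M0 sg)
                (cutoff R₁ R₀ (B5Ineq137Torus.T P 0)) *ᵥ f) x₁‖ ≤
          P.spacing k ^ 2 * (c₀ * (⌊(((P.L : ℝ) ^ k) - 1 + R₀) / sg⌋₊ + 3) ^ (d + 1) * (1 + (P.L : ℝ) ^ k * ((R₀ - R₁)⁻¹ + (sg : ℝ)⁻¹)) *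
            Real.exp (-(1 / (8 * (L : ℝ) ^ s) * (((P.L : ℝ) ^ k)⁻¹ * D))) * F) := by
  obtain ⟨s₀, H⟩ := holder230_regular_cwt d L hL ha e creg β hcreg hβ
  refine ⟨s₀, fun s hs => ?_⟩
  obtain ⟨c₀, e₁, hc₀, he₁, G⟩ := H s hs
  refine ⟨c₀, e₁, hc₀, he₁, ?_⟩
  intro P hPd hPL k hk1 hkK hks hsize A ec hec hece hreg c M0 hfit0 hN0 sg W hsg R R₀ R₁ hRm hR₁ hR10 hW hgap x₁ x₂ hx₁ hdeep₁ hx₂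
    hdeep₂ hT
  obtain ⟨N, sq, cb, h0, hN, hJ, hNle, hchain⟩ := exists_admissible_contour hPd hfit0 hx₁ hdeep₁ hx₂ hdeep₂ hT
  refine ⟨N, sq, cb, h0, hN, hJ, hNle, fun θ hθ0 hθ1 f F D hF hD hD₁ hD₂ => ?_⟩
  have hchain' : ∀ m ≤ N, sq m ∈ (cubeT hPd (P.L ^ k) c fun i => P.L ^ k * M0 i) ∧
      (∀ i, R₀ + R ≤ (boxCoord hPd (P.L ^ k) c (sq m) i : ℝ) ∧ (boxCoord hPd (P.L ^ k) c (sq m) i : ℝ) + (R₀ + R) ≤ (P.L ^ k * M0 i : ℕ) - 1) ∧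
      B5Ineq137Torus.T P 0 x₁ (sq m) ≤ B5Ineq137Torus.T P 0 x₁ x₂ := fun m hm => by
    obtain ⟨h1, h2, h3⟩ := hchain m hm
    exact ⟨h1, fun i => by simpa only [min_self] using h2 i, h3⟩
  exact G P hPd hPL k hk1 hkK hks hsize A ec hec hece hreg c M0 hfit0 hN0 sg W hsg R R₀ R₁ hRm hR₁ hR10 hW hgap θ hθ0 hθ1 x₁ x₂ N sq cb
    h0 hN hJ hNle hchain' f F D hF hD hD₁ hD₂

end ShortestContour

end

end Literature.MathematicalPhysics.QuantumFieldTheory.BalabanImbrieJaffe1984to88.BIJ88LocHolder230RegularTorus
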